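/-
Copyright (c) 2026 the pub-hodgecm-mathlib formalisation cell (harness21).  Prover seat hodgecm-mathlib-LH3-p02 (g6) ((C5)′ lead); dealer LH4-plan (g7) WORD #15∕#23,
2026-09-02.  Count-neutral LAYER C brick of the dyadic (D-UNR) column; CENSUS-C5-InertCountsValuesTrace bd72510a §2 row «FixedPointsSumThetaZero», shape (α) «column-abstract».
-/
import Literature.NumberTheory.Automorphic.UnitaryThreeFixedPointsCountTrace           -- ★ C4-1 p851921 (LH5-p03): Cor. 9 counted for `u_m^{(y,z)}`
import Literature.NumberTheory.Automorphic.UnitaryThreeTorusDoubleCosetsHKTrace          -- ★ F2 p851931 (LH4-p03): Prop. 6 (a), trace torus (brings F1 ★ p851889)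
import Literature.NumberTheory.Automorphic.UnitaryThreeTorusDoubleCosetsHKDisjointTrace  -- ★ F3 p851943 (LH3-p01): Prop. 6 (b), trace torus
import Literature.NumberTheory.Rogawski1990.UnitOrbitalIntegralInertReindex              -- ★ `finsum_comp_two_mul_eq_finsum_ite` (`j = 2i`)
import Literature.NumberTheory.Rogawski1990.UnitOrbitalIntegralInertValuesTheta          -- ★ `finsum_natCast_eq_phiZero`, `natCast_weight_eq_corNineWeight` (Prop. 14, values-abstract)
import HarnessLib

/-!
# Flicker's count at `θ̄ = 0`, H-level, TRACE FRAME and COLUMN-ABSTRACT: `Σ_m #Fix_t(H ⧸ H^K_m) = φ₀(N₁, N₂, N)` from the three column families and the weights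
# (Flicker 1998, Prop. 5 p. 82, Cor. 9 p. 85, Prop. 10 pp. 85–86, Prop. 13 pp. 91–93, Prop. 14 p. 94 — every residue characteristic)

Topic `NumberTheory/Rogawski1990`; namespace `Literature.NumberTheory.Automorphic.UnitaryGroup` (as ★).  THEOREMS ONLY (no `def`, no instance, no notation, no named fact,
no `sorry`; one `synthInstance.maxHeartbeats` bump for the `MulAction` instance on `↥H ⧸ M`, as ★).  Cell `pub/hodgecm-mathlib`, crux H413 = `stmt-HodgeConjecture-24833`;
LH4 board (D-UNR) LAYER C: the trace-frame twin of ★ `UnitOrbitalIntegralInertFixedPointsSumThetaZero` (F0P3b-p01 (g7)), CENSUS-C5 bd72510a61456e21 §2∕§6 (LH3-p02 (g6)),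
shape (α) «COLUMN-ABSTRACT» (LH3-p02 → LH4-plan 16:04Z): ★ takes the `j = 0` column (Prop. 13) as the hypothesis `hI0` and CALLS Prop. 10 at the torus for `j = 2i ≥ 2`; here
ALL three column families AND the weights are hypotheses —

* `hI0 : ∀ m, #{w ∈ P_H ⧸ (P_H ∩ H^K_m) : w̃⁻¹ t w̃ ∈ H^K_m} = iThirteen q N N₊ (max N₁ N₂) m` (Prop. 13 at the trace literal — discharger: (C5)′ `…CountJZeroTorusAllTrace`),
* `hIpos : ∀ i m, 1 ≤ i → 2i ≤ N → #{… (r_i⁻¹ t r_i) …} = iTen q (N − 2i) N₊ m` (Prop. 10 at the torus — (C5)′ `…CountJPosTrace`),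
* `hIvan : ∀ i m, N < 2i → #{… (r_i⁻¹ t r_i) …} = 0` (beyond `j = N` — (C5)′ `…CountJPosVanishingTrace`),
* `hW : ∀ i, [Z_H(t) : Z_H(t) ∩ r_i K_H r_i⁻¹] = if 2i + 0 = 0 then 1 else (q+1)·q^{2i+0−1}` (Prop. 6 (c)∕7 — F4 `…WeightTrace`'s conclusion at `ε = 0`, BYTE FOR BYTE),

so that the file sits on ★ heads only: C4-1 `natCard_fixedPoints_centralizer_eq_finsum_of_rel` (Cor. 9 counted), F2 `exists_mem_centralizer_mul_diagRadial_mul_mem_flickerKH_traceTorus`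
(Prop. 6 (a)), F3 `eq_of_centralizer_mul_diagRadial_mul_flickerKH_eq_trace` (Prop. 6 (b)), ★ `Reindex`, ★ `ValuesTheta` (Prop. 14's θ̄ = 0 identity, values-abstract) — and is
off the Borel-count critical path.  Binders per the (C5) rulings: T1 `{gR} (hgR : IsUnit (σR gR − gR))` (for ★'s `(hdRσ)(hdRu)(h2R)`), T2 `UnramifiedLocalConjDatum` + `(h2 :
(2 : K) ≠ 0)`, T3 the F1 literal `M(x₁,x₂,x₃)` at `π = 1` with `(hb)(hbv)`, C4-1's level family `{y z}(hyv)(hzv)(hz)(u)(hu)`; `N, N₊, N₁, N₂` enter only through the column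
hypotheses and the regime token `h` (★'s), so no valuation of the literal is read here — `N₊ = ord((x₁−x₂)σb + (x₃−x₂)b)` lives in the dischargers.  Conclusion `= phiZero q N₁ N₂ N`
VERBATIM.  FINDING #19 (LH4-plan WORD #37): at a dyadic place with `q ≥ 4` the `j = 0` near-column cell value is CLASS-DEPENDENT at equidistant (type-B) rows, so `hI0` as
written (print's `iThirteen`) may be undischargeable for such `t` — this theorem is a true implication either way; whether the TOTAL `φ₀` survives (D1) or not (D2) is the
decider pending at filing time.  HONEST LABEL: HC_CM is proved only modulo the printed citations (hLiu418 = `stmt-HodgeConjecture-24832`, h413 = `stmt-HodgeConjecture-24833`)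
until rung 0 closes; (D-UNR) stays PRINT by D74′; this is bookkeeping over ★ heads, pays no organ, opens no road; the COUNT heads of the (C6) contract stay hypotheses until
LAYER C's last brick.

## References
* [Flicker1998UnitaryFL] Y. Z. Flicker, *Elementary proof of the fundamental lemma for a unitary group*, Canad. J. Math. 50 (1998): Prop. 5 p. 82, Prop. 6 p. 83, Cor. 9 p. 85,
  Prop. 10 pp. 85–86, Prop. 13 pp. 91–93, Prop. 14 p. 94.
* [Rogawski1990] J. D. Rogawski, *Automorphic Representations of Unitary Groups in Three Variables* (1990), §4.9 p. 55.
-/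

set_option autoImplicit false

open scoped MatrixGroups WithZero Valued
open Matrix

namespace Literature.NumberTheory.Automorphic

namespace UnitaryGroup

open Literature.NumberTheory.Automorphic.HermitianLattice (unitaryInt mem_unitaryInt_iff UnramifiedLocalConjDatum)
open Literature.NumberTheory.Rogawski1990.Flicker1998 (iThirteen iTen corNineWeight phiZero natCast_weight_eq_corNineWeight finsum_natCast_eq_phiZero
  finsum_comp_two_mul_eq_finsum_ite)

universe u

variable {K : Type*} [Field K] [Valued K ℤᵐ⁰] {ϖ : K} (σ : K →+* K) {J : Matrix (Fin 3) (Fin 3) K}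

section ThetaZeroTrace

set_option synthInstance.maxHeartbeats 120000 in
-- the `MulAction` instance of `↥H` on `↥H ⧸ M` (as in ★ `natCard_fixedPoints_centralizer_eq_finsum_of_rel`)
/-- **`Σᶠ_m #Fix_t(H ⧸ H^K_m) = φ₀(N₁,N₂,N)` for the TRACE torus literal `t = M(x₁,x₂,x₃)` (`θ̄ = 0`), COLUMN-ABSTRACT** — from the column families `hI0` (Prop. 13),
`hIpos` (Prop. 10, `j = 2i ≤ N`), `hIvan` (`j > N`) and the weights `hW` (Prop. 7), via Cor. 9 counted (★ C4-1), Prop. 6 (a)(b) in the trace frame (★ F2∕F3), the re-indexing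
`j = 2i` and Prop. 14's `θ̄ = 0` identity (★ `finsum_natCast_eq_phiZero`).  Twin of ★ `finsum_natCard_fixedPoints_eq_phiZero_of_column` with NO `|2| = 1`, NO `yσy = −2`, NO `2e = 1`.
[cite: Flicker1998UnitaryFL, Prop. 5 p. 82; Cor. 9 p. 85; Prop. 10 p. 85; Prop. 13 p. 91; Prop. 14 p. 94] -/
theorem finsum_natCard_fixedPoints_traceTorus_eq_phiZero_of_columns (hJ : J = (StdForm.antidiagonal 3).over K) (hd : UnramifiedLocalConjDatum σ ϖ)
    (h2 : (2 : K) ≠ 0)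
    -- the 2-free level elements `u m = u_m^{(y,z)}`
    {y z : K} (hyv : Valued.v y = 1) (hzv : Valued.v z ≤ 1) (hz : z + σ z + y * σ y = 0)
    {c : ↥(unitaryGroupOfForm σ J)} (hc : ((c : GL (Fin 3) K) : Matrix (Fin 3) (Fin 3) K) = !![1, 0, 0; 0, -1, 0; 0, 0, 1])
    (u : ℕ → ↥(unitaryGroupOfForm σ J))
    (hu : ∀ m, ((u m : GL (Fin 3) K) : Matrix (Fin 3) (Fin 3) K) = !![ϖ ^ m, y, z * (ϖ ^ m)⁻¹; 0, 1, -σ y * (ϖ ^ m)⁻¹; 0, 0, (ϖ ^ m)⁻¹])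
    -- the integer frame of F2 (ring generator `gR`, T1)
    {R : Type u} [CommRing R] [IsDomain R] [IsDiscreteValuationRing R] (ι : R →+* K) (hι : Function.Injective ι)
    (hιv : ∀ x : K, Valued.v x ≤ 1 ↔ x ∈ Set.range ι) (σR : R →+* R) (hσR : ∀ r, σR (σR r) = r) (hσι : ∀ r, ι (σR r) = σ (ι r))
    {gR : R} (hgR : IsUnit (σR gR - gR)) {ϖR : R} (hϖR : Irreducible ϖR) (hιϖ : ι ϖR = ϖ)
    -- the trace torus literal at `π = 1` and the radial family
    {b : K} (hb : b + σ b = 1) (hbv : Valued.v b ≤ 1) {x₁ x₂ x₃ : K} (hx : x₁ ≠ x₃)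
    {t : ↥(unitaryGroupOfForm σ J)}
    (hte : ((t : GL (Fin 3) K) : Matrix (Fin 3) (Fin 3) K) =
      !![x₁ * σ b + x₃ * b, 0, x₁ - x₃; 0, x₂, 0; b * σ b * (x₁ - x₃), 0, x₁ * b + x₃ * σ b])
    (htH : t ∈ Subgroup.centralizer ({c} : Set ↥(unitaryGroupOfForm σ J)))
    (r : ℕ → ↥(Subgroup.centralizer ({c} : Set ↥(unitaryGroupOfForm σ J))))
    (hr : ∀ i, (((r i : ↥(unitaryGroupOfForm σ J)) : GL (Fin 3) K) : Matrix (Fin 3) (Fin 3) K) = !![(ϖ ^ i)⁻¹, 0, 0; 0, 1, 0; 0, 0, ϖ ^ i])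
    -- residue cardinality, weights (Prop. 7 = F4's conclusion at `ε = 0`), regime, columns, finiteness
    {q : ℕ} (hq : 1 < q)
    (hW : ∀ i, (((flickerKH σ J c).subgroupOf (Subgroup.centralizer ({c} : Set ↥(unitaryGroupOfForm σ J)))).map (MulAut.conj (r i)).toMonoidHom).relIndex
        (Subgroup.centralizer ({⟨t, htH⟩} : Set ↥(Subgroup.centralizer ({c} : Set ↥(unitaryGroupOfForm σ J))))) =
      if 2 * i + 0 = 0 then 1 else (q + 1) * q ^ (2 * i + 0 - 1))
    {N Np N₁ N₂ : ℕ} (h : (N₁ < N ∧ N₂ = N₁ ∧ Np = N₁) ∨ (N ≤ N₁ ∧ N ≤ Np))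
    (hI0 : ∀ m, (Nat.card {w : ↥(flickerPH σ J c) ⧸ (flickerHK σ J c (u m)).subgroupOf (flickerPH σ J c) //
      ((Quotient.out w : ↥(flickerPH σ J c)) : ↥(unitaryGroupOfForm σ J))⁻¹ * t * (Quotient.out w : ↥(flickerPH σ J c)) ∈ flickerHK σ J c (u m)} : ℚ) =
        iThirteen q N Np (max N₁ N₂) m)
    (hIpos : ∀ i m, 1 ≤ i → 2 * i ≤ N → (Nat.card {w : ↥(flickerPH σ J c) ⧸ (flickerHK σ J c (u m)).subgroupOf (flickerPH σ J c) //
      ((Quotient.out w : ↥(flickerPH σ J c)) : ↥(unitaryGroupOfForm σ J))⁻¹ *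
        ((r i : ↥(unitaryGroupOfForm σ J))⁻¹ * t * (r i : ↥(unitaryGroupOfForm σ J))) * (Quotient.out w : ↥(flickerPH σ J c)) ∈ flickerHK σ J c (u m)} : ℚ) =
        iTen q (N - 2 * i) Np m)
    (hIvan : ∀ i m, N < 2 * i → Nat.card {w : ↥(flickerPH σ J c) ⧸ (flickerHK σ J c (u m)).subgroupOf (flickerPH σ J c) //
      ((Quotient.out w : ↥(flickerPH σ J c)) : ↥(unitaryGroupOfForm σ J))⁻¹ *
        ((r i : ↥(unitaryGroupOfForm σ J))⁻¹ * t * (r i : ↥(unitaryGroupOfForm σ J))) * (Quotient.out w : ↥(flickerPH σ J c)) ∈ flickerHK σ J c (u m)} = 0)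
    (hfin : ∀ m, {x : ↥(Subgroup.centralizer ({c} : Set ↥(unitaryGroupOfForm σ J))) ⧸
      (flickerHK σ J c (u m)).subgroupOf (Subgroup.centralizer ({c} : Set ↥(unitaryGroupOfForm σ J))) |
        (⟨t, htH⟩ : ↥(Subgroup.centralizer ({c} : Set ↥(unitaryGroupOfForm σ J)))) • x = x}.Finite) :
    ∑ᶠ m, (Nat.card {x : ↥(Subgroup.centralizer ({c} : Set ↥(unitaryGroupOfForm σ J))) ⧸
        (flickerHK σ J c (u m)).subgroupOf (Subgroup.centralizer ({c} : Set ↥(unitaryGroupOfForm σ J))) //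
        (⟨t, htH⟩ : ↥(Subgroup.centralizer ({c} : Set ↥(unitaryGroupOfForm σ J)))) • x = x} : ℚ) = phiZero q N₁ N₂ N := by
  classical
  have hq1 : 1 ≤ q := le_of_lt hq
  -- `T = Z_H(t)` commutes with `t`
  have hT : ∀ τ ∈ Subgroup.centralizer ({(⟨t, htH⟩ : ↥(Subgroup.centralizer ({c} : Set ↥(unitaryGroupOfForm σ J))))} :
        Set ↥(Subgroup.centralizer ({c} : Set ↥(unitaryGroupOfForm σ J)))),
      τ * (⟨t, htH⟩ : ↥(Subgroup.centralizer ({c} : Set ↥(unitaryGroupOfForm σ J)))) =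
        (⟨t, htH⟩ : ↥(Subgroup.centralizer ({c} : Set ↥(unitaryGroupOfForm σ J)))) * τ :=
    fun τ hτ => ((Subgroup.mem_centralizer_iff.1 hτ) (⟨t, htH⟩ : ↥(Subgroup.centralizer ({c} : Set ↥(unitaryGroupOfForm σ J)))) (Set.mem_singleton _)).symm
  -- ★ F2∕F3: cover and disjointness at `ε = 0`, `π = π′ = 1` (the literal with the `π`-slots filled by `1`)
  have hε : (0 : ℕ) ≤ 1 := Nat.zero_le 1
  have hπε : (1 : K) = ϖ ^ (0 : ℕ) := (pow_zero ϖ).symm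
  have hππ : (1 : K) * 1 = 1 := mul_one 1
  have hte1 : ((t : GL (Fin 3) K) : Matrix (Fin 3) (Fin 3) K) =
      !![x₁ * σ b + x₃ * b, 0, 1 * (x₁ - x₃); 0, x₂, 0; 1 * (b * σ b * (x₁ - x₃)), 0, x₁ * b + x₃ * σ b] := by
    rw [hte, one_mul, one_mul]
  have hA := fun g => exists_mem_centralizer_mul_diagRadial_mul_mem_flickerKH_traceTorus σ hJ hd h2 ι hι hιv σR hσR hσι hgR hϖR hιϖ hc
    hε hπε hππ hb hbv htH hte1 r hr g
  have hB := eq_of_centralizer_mul_diagRadial_mul_flickerKH_eq_trace σ hJ hd h2 hc hb hbv hππ hπε htH hx hte1 r hr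
  -- the weights in `ℚ`
  have hW' : ∀ i, ((((flickerKH σ J c).subgroupOf (Subgroup.centralizer ({c} : Set ↥(unitaryGroupOfForm σ J)))).map (MulAut.conj (r i)).toMonoidHom).relIndex
      (Subgroup.centralizer ({(⟨t, htH⟩ : ↥(Subgroup.centralizer ({c} : Set ↥(unitaryGroupOfForm σ J))))} :
        Set ↥(Subgroup.centralizer ({c} : Set ↥(unitaryGroupOfForm σ J))))) : ℚ) = corNineWeight q (2 * i) := by
    intro i
    rw [hW i, show 2 * i + 0 = 2 * i from rfl, ← natCast_weight_eq_corNineWeight hq1 (2 * i)]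
  -- the columns `I(j, m)`
  set I : ℕ → ℕ → ℚ := fun j m => if j = 0 then iThirteen q N Np (max N₁ N₂) m else if j ≤ N then iTen q (N - j) Np m else 0 with hIdef
  have hr0 : (r 0 : ↥(unitaryGroupOfForm σ J)) = 1 := by
    apply Subtype.ext; apply Units.ext
    rw [hr 0, pow_zero, inv_one]
    ext i j; fin_cases i <;> fin_cases j <;> rfl
  have hconj : ∀ i, (((r i)⁻¹ * (⟨t, htH⟩ : ↥(Subgroup.centralizer ({c} : Set ↥(unitaryGroupOfForm σ J)))) * r i :
      ↥(Subgroup.centralizer ({c} : Set ↥(unitaryGroupOfForm σ J)))) : ↥(unitaryGroupOfForm σ J)) =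
        (r i : ↥(unitaryGroupOfForm σ J))⁻¹ * t * (r i : ↥(unitaryGroupOfForm σ J)) := fun i => rfl
  have hcol : ∀ i m, (Nat.card {w : ↥(flickerPH σ J c) ⧸ (flickerHK σ J c (u m)).subgroupOf (flickerPH σ J c) //
      ((Quotient.out w : ↥(flickerPH σ J c)) : ↥(unitaryGroupOfForm σ J))⁻¹ *
        (((r i)⁻¹ * (⟨t, htH⟩ : ↥(Subgroup.centralizer ({c} : Set ↥(unitaryGroupOfForm σ J)))) * r i :
          ↥(Subgroup.centralizer ({c} : Set ↥(unitaryGroupOfForm σ J)))) : ↥(unitaryGroupOfForm σ J)) *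
        (Quotient.out w : ↥(flickerPH σ J c)) ∈ flickerHK σ J c (u m)} : ℚ) = I (2 * i) m := by
    intro i m
    rw [hconj]
    rcases Nat.eq_zero_or_pos i with rfl | hi
    · rw [hr0, inv_one, one_mul, mul_one, hI0 m, hIdef]; simp
    by_cases hiN : 2 * i ≤ N
    · rw [hIpos i m hi hiN, hIdef]
      simp only
      rw [if_neg (by omega), if_pos hiN]
    · rw [hIvan i m (by omega), Nat.cast_zero, hIdef]
      simp only
      rw [if_neg (by omega), if_neg (by omega)]
  -- Cor. 9 at each level, in `ℚ`
  have hlevel : ∀ m, (Nat.card {x : ↥(Subgroup.centralizer ({c} : Set ↥(unitaryGroupOfForm σ J))) ⧸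
      (flickerHK σ J c (u m)).subgroupOf (Subgroup.centralizer ({c} : Set ↥(unitaryGroupOfForm σ J))) //
        (⟨t, htH⟩ : ↥(Subgroup.centralizer ({c} : Set ↥(unitaryGroupOfForm σ J)))) • x = x} : ℚ) =
      ∑ᶠ j, (if j % 2 = 0 then corNineWeight q j * I j m else 0) := by
    intro m
    rw [natCard_fixedPoints_centralizer_eq_finsum_of_rel σ hJ hd h2 hyv hzv hz m (hu m) hc r
      (⟨t, htH⟩ : ↥(Subgroup.centralizer ({c} : Set ↥(unitaryGroupOfForm σ J))))
      (Subgroup.centralizer ({(⟨t, htH⟩ : ↥(Subgroup.centralizer ({c} : Set ↥(unitaryGroupOfForm σ J))))} :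
        Set ↥(Subgroup.centralizer ({c} : Set ↥(unitaryGroupOfForm σ J))))) hT hA hB (hfin m)]
    have hsupp : (Function.support fun i => (((flickerKH σ J c).subgroupOf (Subgroup.centralizer ({c} : Set ↥(unitaryGroupOfForm σ J)))).map
        (MulAut.conj (r i)).toMonoidHom).relIndex
        (Subgroup.centralizer ({(⟨t, htH⟩ : ↥(Subgroup.centralizer ({c} : Set ↥(unitaryGroupOfForm σ J))))} :
          Set ↥(Subgroup.centralizer ({c} : Set ↥(unitaryGroupOfForm σ J))))) *
        Nat.card {w : ↥(flickerPH σ J c) ⧸ (flickerHK σ J c (u m)).subgroupOf (flickerPH σ J c) //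
          ((Quotient.out w : ↥(flickerPH σ J c)) : ↥(unitaryGroupOfForm σ J))⁻¹ *
            (((r i)⁻¹ * (⟨t, htH⟩ : ↥(Subgroup.centralizer ({c} : Set ↥(unitaryGroupOfForm σ J)))) * r i :
              ↥(Subgroup.centralizer ({c} : Set ↥(unitaryGroupOfForm σ J)))) : ↥(unitaryGroupOfForm σ J)) *
            (Quotient.out w : ↥(flickerPH σ J c)) ∈ flickerHK σ J c (u m)}).Finite := by
      refine (Set.finite_Iic N).subset fun i hi => ?_
      rw [Function.mem_support] at hi
      by_contra hgt
      rw [Set.mem_Iic, not_le] at hgt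
      apply hi
      rw [hconj, hIvan i m (by omega), mul_zero]
    have hcast := (Nat.castAddMonoidHom ℚ).map_finsum hsupp
    simp only [Nat.coe_castAddMonoidHom] at hcast
    rw [hcast, ← finsum_comp_two_mul_eq_finsum_ite (fun j => corNineWeight q j * I j m)]
    refine finsum_congr fun i => ?_
    rw [Nat.cast_mul, hW' i, hcol i m]
  -- Prop. 14's `θ̄ = 0` identity
  have h0 : ∀ m, I 0 m = iThirteen q N Np (max N₁ N₂) m := fun m => by rw [hIdef]; simp
  have hpos : ∀ j m, 1 ≤ j → j ≤ N → I j m = iTen q (N - j) Np m := fun j m hj hjN => by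
    rw [hIdef]; simp only; rw [if_neg (by omega), if_pos hjN]
  have hbig : ∀ j m, N < j → I j m = 0 := fun j m hj => by
    rw [hIdef]; simp only; rw [if_neg (by omega), if_neg (by omega)]
  exact finsum_natCast_eq_phiZero q I h0 hpos hbig hq rfl h _ hlevel

end ThetaZeroTrace

end UnitaryGroup

end Literature.NumberTheory.Automorphic
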